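import Literature.NumberTheory.EllipticCurves.ProfiniteGroupDistribution
import Literature.GroupTheory.Abelian.MonoidHomSpanFunctions
import HarnessLib

/-!
# Integrals of coset indicators against a bounded distribution on a group, from its integrals against
# the characters of a finite abelian quotient (de Shalit 1987, II.4.12 Remark (iv), II.5.2 (3)–(4))

De Shalit II.5.2 (3)–(4) (p. 79–80) evaluates a measure on the cosets of `Gal(K(𝔤)/K)` by summing its
integrals against the finite-order characters `χ` with the weights `χ⁻¹(𝔠)`; II.4.12 Remark (iv)
(p. 67): the measure is determined by its integrals against characters. The algebra is finite Fourier
inversion — `Literature/GroupTheory/Abelian/MonoidHomSpanFunctions.lean` (the characters `Q →* F` of a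
finite abelian group with values in a field `F` with enough roots of unity SPAN the functions `Q → F`,
`CharacterSpan.exists_sum_smul_monoidHom_eq`). THIS file puts it under the integral of the tree's
`GroupDistribution` (`ProfiniteGroupDistribution.lean`):

* `norm_map_monoidHom_apply_eq_one` — a character value of a finite group, read in a normed field
  through a ring map `c : F →+* 𝕜` (e.g. `ℚ̄_p → ℂ_p`), has norm `1`;
* `isTowerContinuous_comp_of_proj_eq` — a function of `π σ`, `π` constant on the cosets of a level
  `U_N`, is tower-continuous;
* ★★ `GroupDistribution.integral_ite_comp_mul_eq_zero_of_forall_monoidHom` — for a bounded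
  distribution `D` on a group `G` along a tower `𝒰` (values in a complete ultrametric field `𝕜`), a
  homomorphism `π : G →* Q` to a finite abelian group (`Group` + `IsMulCommutative`, the shape of the
  tree's `Gal(K(𝔣)/K)`) constant on the cosets of some `U_N`, and a bounded tower-continuous `g`:
  **if `∫ c(χ(πσ))·g(σ) dD = 0` for every character `χ : Q →* F`, then `∫ 𝟙_{πσ = q₀}·g(σ) dD = 0`
  for every `q₀ ∈ Q`** — the Fourier step (ii) of the `j = 0` uniqueness (the indicator of a coset of
  `Gal(K̄/K(𝔣′))` against `φ̂₀^m·ν` is a combination of the integrals of the avatars `χ̂·φ̂₀^m`);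
  `…_units` — the same with `χ : Q →* Fˣ`.

Everything is a theorem; no named facts, no definitions, no instances, no `sorry`.

## References

* [deShalit1987] E. de Shalit, *Iwasawa theory of elliptic curves with complex multiplication* (1987),
  II.4.12 Remark (iv) (p. 67), II.5.2 (3)–(4) (p. 79–80).
* [Washington1997] L. C. Washington, *Introduction to Cyclotomic Fields*, §3 (Lemma 3.8 ff.), Lemma 4.7.
-/

noncomputable section

open scoped Classical

namespace Literature.NumberTheory.EllipticCurves

open Literature.GroupTheory.Abelian

/-! ### §1. Character values have norm one; functions of a finite quotient are tower-continuous -/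

section Values

variable {Q : Type*} [Group Q] [Finite Q] {F : Type*} [Field F]

/-- The values of a character `χ : Q →* F` of a finite group are roots of unity, hence of norm `1`
under any ring map into a normed field. [cite: Washington1997, §3] -/
theorem norm_map_monoidHom_apply_eq_one {𝕜 : Type*} [NormedField 𝕜] (c : F →+* 𝕜) (χ : Q →* F)
    (q : Q) : ‖c (χ q)‖ = 1 := by
  have hn : Monoid.exponent Q ≠ 0 := Monoid.exponent_ne_zero_of_finite
  have hpow : (c (χ q)) ^ Monoid.exponent Q = 1 := by
    rw [← map_pow, ← map_pow, Monoid.pow_exponent_eq_one, map_one, map_one]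
  have h := congrArg norm hpow
  rw [norm_pow, norm_one] at h
  exact (pow_eq_one_iff_of_nonneg (norm_nonneg _) hn).mp h

end Values

namespace GroupDistribution

variable {G : Type*} [Group G] {𝒰 : SubgroupTower G}

/-- A function of `π σ`, `π` constant on the level-`N` cosets of `𝒰`, is tower-continuous.
[cite: deShalit1987, I.3.1 (p. 16)] -/
theorem isTowerContinuous_comp_of_proj_eq {Q : Type*} {E : Type*} [PseudoMetricSpace E] (π : G → Q)
    {N : ℕ} (hN : ∀ σ τ : G, 𝒰.proj N σ = 𝒰.proj N τ → π σ = π τ) (f : Q → E) :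
    𝒰.IsTowerContinuous (fun σ ↦ f (π σ)) :=
  SubgroupTower.IsTowerContinuous.of_factorsThrough (m := N) (fun a ↦ f (π (𝒰.repr N a)))
    fun σ ↦ by rw [hN σ (𝒰.repr N (𝒰.proj N σ)) (𝒰.proj_repr N _).symm]

/-! ### §2. Coset indicators from characters, under the integral -/

variable {𝕜 : Type*} [NormedField 𝕜] [IsUltrametricDist 𝕜] [CompleteSpace 𝕜] (D : GroupDistribution 𝒰 𝕜)
  {Q : Type*} [Group Q] [IsMulCommutative Q] [Finite Q]
  {F : Type*} [Field F] [HasEnoughRootsOfUnity F (Monoid.exponent Q)]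

/-- ★★ **Coset indicators from characters.** Let `D` be a bounded distribution on `G` along `𝒰`,
`π : G →* Q` a homomorphism to a finite abelian group, constant on the cosets of some level `U_N`,
`c : F →+* 𝕜` a ring map from a field with enough roots of unity (e.g. `ℚ̄_p → ℂ_p`), and
`g : G → 𝕜` bounded and tower-continuous. If `∫ c(χ(πσ))·g(σ) dD = 0` for every character
`χ : Q →* F`, then `∫ 𝟙_{πσ = q₀}·g(σ) dD = 0` for every `q₀ ∈ Q`: the indicator `𝟙_{q = q₀}` is an
`F`-combination of characters (`CharacterSpan.exists_sum_smul_monoidHom_eq`), and the integral is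
additive. [cite: deShalit1987, II.5.2 (3)–(4) (p. 79–80), II.4.12 Remark (iv) (p. 67)] [cite: Washington1997, Lemma 4.7] -/
theorem integral_ite_comp_mul_eq_zero_of_forall_monoidHom (π : G →* Q)
    {N : ℕ} (hN : ∀ σ τ : G, 𝒰.proj N σ = 𝒰.proj N τ → π σ = π τ) (c : F →+* 𝕜)
    {g : G → 𝕜} (hg : 𝒰.IsTowerContinuous g) {M : ℝ} (hM : ∀ σ, ‖g σ‖ ≤ M)
    (h : ∀ χ : Q →* F, D.integral (fun σ ↦ c (χ (π σ)) * g σ) = 0) (q₀ : Q) :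
    D.integral (fun σ ↦ (if π σ = q₀ then (1 : 𝕜) else 0) * g σ) = 0 := by
  letI : CommGroup Q := { toGroup := ‹Group Q›, mul_comm := mul_comm' }
  haveI : Finite (Q →* F) := CharacterSpan.finite_monoidHom Q F
  letI : Fintype (Q →* F) := Fintype.ofFinite _
  -- Fourier expansion of the indicator of `q₀`, in `F`
  obtain ⟨a, ha⟩ :=
    CharacterSpan.exists_sum_smul_monoidHom_eq Q F (fun q ↦ if q = q₀ then (1 : F) else 0)
  have hind : ∀ σ, (if π σ = q₀ then (1 : 𝕜) else 0) * g σ =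
      ∑ χ : Q →* F, c (a χ) * (c (χ (π σ)) * g σ) := by
    intro σ
    have h1 : (if π σ = q₀ then (1 : 𝕜) else 0) = c (if π σ = q₀ then (1 : F) else 0) := by
      split_ifs <;> simp
    have h2 : (if π σ = q₀ then (1 : F) else 0) = ∑ χ : Q →* F, a χ * χ (π σ) := by
      have := congrFun ha (π σ)
      simpa only [Finset.sum_apply, Pi.smul_apply, smul_eq_mul] using this.symm
    rw [h1, h2, map_sum, Finset.sum_mul]
    refine Finset.sum_congr rfl fun χ _ ↦ ?_
    rw [map_mul, mul_assoc]
  have hM1 : ∀ (χ : Q →* F) σ, ‖c (χ (π σ))‖ ≤ max M 1 := fun χ σ ↦ by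
    rw [norm_map_monoidHom_apply_eq_one]; exact le_max_right _ _
  have hcont : ∀ χ : Q →* F, 𝒰.IsTowerContinuous (fun σ ↦ c (χ (π σ)) * g σ) := fun χ ↦
    (isTowerContinuous_comp_of_proj_eq π hN (fun q ↦ c (χ q))).mul hg (hM1 χ)
      fun σ ↦ (hM σ).trans (le_max_left _ _)
  rw [D.integral_congr hind, D.integral_finset_sum _ (fun χ _ ↦ (hcont χ).const_mul _)]
  refine Finset.sum_eq_zero fun χ _ ↦ ?_
  rw [D.integral_const_mul _ (hcont χ), h χ, mul_zero]

/-- The same with the character values read through the units (`χ : Q →* Fˣ`), the currency of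
`p`-adic avatars of finite-order characters. [cite: deShalit1987, II.5.2 (3)–(4) (p. 79–80)] -/
theorem integral_ite_comp_mul_eq_zero_of_forall_monoidHom_units (π : G →* Q)
    {N : ℕ} (hN : ∀ σ τ : G, 𝒰.proj N σ = 𝒰.proj N τ → π σ = π τ) (c : F →+* 𝕜)
    {g : G → 𝕜} (hg : 𝒰.IsTowerContinuous g) {M : ℝ} (hM : ∀ σ, ‖g σ‖ ≤ M)
    (h : ∀ χ : Q →* Fˣ, D.integral (fun σ ↦ c ((χ (π σ) : Fˣ) : F) * g σ) = 0) (q₀ : Q) :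
    D.integral (fun σ ↦ (if π σ = q₀ then (1 : 𝕜) else 0) * g σ) = 0 := by
  refine D.integral_ite_comp_mul_eq_zero_of_forall_monoidHom π hN c hg hM (fun χ ↦ ?_) q₀
  have h' := h (MonoidHom.toHomUnits χ)
  simpa only [MonoidHom.coe_toHomUnits] using h'

end GroupDistribution

end Literature.NumberTheory.EllipticCurves

end
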